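import Mathlib
import Summits.Ventures.PercRepro2.Defs
import Summits.Ventures.PercRepro2.Independence
import Summits.Ventures.PercRepro2.Harris
import Summits.Ventures.PercRepro2.Graph
import Summits.Ventures.PercRepro2.Exploration
import Summits.Ventures.PercRepro2.FourFunctions
import Summits.Ventures.PercRepro2.Induced
import Summits.Ventures.PercRepro2.Frontier

/-!
# Multi-source conditional correlation inequality (blind cell PercRepro2, p1)

Several sources `T ⊆ V` instead of one: `R_X = {s ↮ x ∀ s ∈ T, x ∈ X}` (no source reaches `X`)
and `Q_A = {s ↔ a ∀ s ∈ T, a ∈ A s}` for an assignment `A : V → Finset V`. Then (`vdBK_multi`)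
`P(Q_A ∩ R_X) · P(Q_B ∩ R_Y) ≤ P(Q_{A ∪ B} ∩ R_{X ∩ Y}) · P(R_{X ∪ Y})` (`A ∪ B` pointwise);
the case `T = {s₁, s₂}`, `A = (s₁ ↦ {a})`, `B = (s₂ ↦ {b})`, `X = Y = {t}` (`vdBK_two_sources`)
says that conditionally on `{s₁ ↮ t, s₂ ↮ t}` the events `s₁ ↔ a` and `s₂ ↔ b` are positively
correlated. `T = {s}` is van den Berg–Kahn's Theorem 1.2 (`VdBKahn.lean`); the proof is the same
exploration argument, with the per-source domain Markov identity of `Frontier.lean`. The common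
avoided set is essential (different avoided vertices: false on the path `s₁ – c – s₂`).
-/

namespace Summit.Ventures.PercRepro2

/-! ## The events `Q^U_{T,A}` and `R^U_{T,X}` -/

section MultiEvents

variable {V : Type*} {E : Type*} {ends : E → Sym2 V} {U T : Finset V}

/-- `Q^U_{T,A}` is increasing. -/
lemma isUpperSet_QEventT (ends : E → Sym2 V) (U T : Finset V) (A : V → Finset V) :
    IsUpperSet (QEventT ends U T A) :=
  fun _ _ h hω s hs a ha => conn_mono (induced_mono h) (hω s hs a ha)

/-- `R^U_{T,X}` is decreasing. -/
lemma isLowerSet_REventT (ends : E → Sym2 V) (U T : Finset V) (X : Finset V) :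
    IsLowerSet (REventT ends U T X) :=
  fun _ _ h hω s hs x hx hc => hω s hs x hx (conn_mono (induced_mono h) hc)

/-- `Q^U_{T,A ∪ B} = Q^U_{T,A} ∩ Q^U_{T,B}` (`A ∪ B` pointwise). -/
lemma QEventT_union [DecidableEq V] (ends : E → Sym2 V) (U T : Finset V) (A B : V → Finset V) :
    QEventT ends U T (fun s => A s ∪ B s) = QEventT ends U T A ∩ QEventT ends U T B := by
  ext ω
  simp only [mem_QEventT, Set.mem_inter_iff, Finset.forall_mem_union]
  exact ⟨fun h => ⟨fun s hs => (h s hs).1, fun s hs => (h s hs).2⟩,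
    fun h s hs => ⟨h.1 s hs, h.2 s hs⟩⟩

/-- `R^U_{T,X ∪ Y} = R^U_{T,X} ∩ R^U_{T,Y}`. -/
lemma REventT_union [DecidableEq V] (ends : E → Sym2 V) (U T : Finset V) (X Y : Finset V) :
    REventT ends U T (X ∪ Y) = REventT ends U T X ∩ REventT ends U T Y := by
  ext ω
  simp only [mem_REventT, Set.mem_inter_iff, Finset.forall_mem_union]
  exact ⟨fun h => ⟨fun s hs => (h s hs).1, fun s hs => (h s hs).2⟩,
    fun h s hs => ⟨h.1 s hs, h.2 s hs⟩⟩

/-- With no targets, `Q^U_{T,∅}` is the sure event. -/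
@[simp] lemma QEventT_empty (ends : E → Sym2 V) (U T : Finset V) :
    QEventT ends U T (fun _ => ∅) = Set.univ := by
  ext ω; simp

/-- `R^U_{T,∅}` is the sure event. -/
@[simp] lemma REventT_empty (ends : E → Sym2 V) (U T : Finset V) :
    REventT ends U T ∅ = Set.univ := by
  ext ω; simp

/-- `R^U_{T,X}` is antitone in `X`. -/
lemma REventT_anti (ends : E → Sym2 V) (U T : Finset V) {X X' : Finset V} (h : X ⊆ X') :
    REventT ends U T X' ⊆ REventT ends U T X :=
  fun _ hω s hs x hx => hω s hs x (h hx)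

/-- If a source lies in `X` then `R^U_{T,X}` is empty. -/
lemma REventT_eq_empty_of_mem (ends : E → Sym2 V) (U : Finset V) {T X : Finset V} {s : V}
    (hs : s ∈ T) (hx : s ∈ X) : REventT ends U T X = ∅ := by
  ext ω
  simp only [mem_REventT, Set.mem_empty_iff_false, iff_false, not_forall, not_not]
  exact ⟨s, hs, s, hx, conn_refl _ _ _⟩

/-- `Q^U_{T,A}` is determined by the edges inside `U`. -/
lemma dependsOn_QEventT (ends : E → Sym2 V) (U T : Finset V) (A : V → Finset V) :
    DependsOn (· ∈ QEventT ends U T A) (within ends (↑U)) := by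
  intro ω ω' h
  show (∀ s ∈ T, ∀ a ∈ A s, Conn ends (induced ends (↑U) ω) s a) =
    ∀ s ∈ T, ∀ a ∈ A s, Conn ends (induced ends (↑U) ω') s a
  rw [induced_congr h]

/-- `R^U_{T,X}` is determined by the edges inside `U`. -/
lemma dependsOn_REventT (ends : E → Sym2 V) (U T : Finset V) (X : Finset V) :
    DependsOn (· ∈ REventT ends U T X) (within ends (↑U)) := by
  intro ω ω' h
  show (∀ s ∈ T, ∀ x ∈ X, ¬ Conn ends (induced ends (↑U) ω) s x) =
    ∀ s ∈ T, ∀ x ∈ X, ¬ Conn ends (induced ends (↑U) ω') s x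
  rw [induced_congr h]

end MultiEvents

/-! ## The domain Markov identity for several sources -/

section MultiDMP

variable {V : Type*} {E : Type*} [Fintype E] [DecidableEq V] {ends : E → Sym2 V}

/-- **Pointwise domain Markov identity, several sources**: if no source lies in `Z ⊆ U`,
`Q^U_{T,C} ∩ R^U_{T,W ∪ Z} = {ω | ω ∈ Q^{U∖Z}_{T,C} ∩ R^{U∖Z}_{T,W ∪ frontier ω}}`. -/
theorem QEventT_inter_REventT_union_eq {U Z : Finset V} (hZU : Z ⊆ U) {T : Finset V}
    (hTZ : ∀ s ∈ T, s ∉ Z) (C : V → Finset V) (W : Finset V) :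
    QEventT ends U T C ∩ REventT ends U T (W ∪ Z) =
      {ω | ω ∈ QEventT ends (U \ Z) T C ∩
        REventT ends (U \ Z) T (W ∪ frontier ends U Z ω)} := by
  ext ω
  simp only [Set.mem_inter_iff, Set.mem_setOf_eq, mem_QEventT, mem_REventT]
  have key : ∀ s ∈ T,
      ((∀ a ∈ C s, Conn ends (induced ends (↑U) ω) s a) ∧
        ∀ x ∈ W ∪ Z, ¬ Conn ends (induced ends (↑U) ω) s x) ↔
      ((∀ a ∈ C s, Conn ends (induced ends (↑(U \ Z)) ω) s a) ∧
        ∀ x ∈ W ∪ frontier ends U Z ω, ¬ Conn ends (induced ends (↑(U \ Z)) ω) s x) := by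
    intro s hs
    have := Set.ext_iff.1 (QEvent_inter_REvent_union_eq (ends := ends) hZU (hTZ s hs) (C s) W) ω
    simpa only [Set.mem_inter_iff, Set.mem_setOf_eq, mem_QEvent, mem_REvent] using this
  constructor
  · rintro ⟨hQ, hR⟩
    exact ⟨fun s hs => ((key s hs).1 ⟨hQ s hs, hR s hs⟩).1,
      fun s hs => ((key s hs).1 ⟨hQ s hs, hR s hs⟩).2⟩
  · rintro ⟨hQ, hR⟩
    exact ⟨fun s hs => ((key s hs).2 ⟨hQ s hs, hR s hs⟩).1,
      fun s hs => ((key s hs).2 ⟨hQ s hs, hR s hs⟩).2⟩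

variable [DecidableEq E] [Fintype V] {R : Type*} [CommRing R]

/-- **Domain Markov identity in probability, several sources**: if no source lies in `Z ⊆ U`,
`P(Q^U_{T,C} ∩ R^U_{T,W ∪ Z}) = ∑_ω weight p ω · P(Q^{U∖Z}_{T,C} ∩ R^{U∖Z}_{T,W ∪ frontier ω})`. -/
theorem prob_QEventT_inter_REventT_union (p : E → R) (ends : E → Sym2 V) {U Z : Finset V}
    (hZU : Z ⊆ U) {T : Finset V} (hTZ : ∀ s ∈ T, s ∉ Z) (C : V → Finset V) (W : Finset V) :
    prob p (QEventT ends U T C ∩ REventT ends U T (W ∪ Z)) =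
      ∑ ω, weight p ω * prob p (QEventT ends (U \ Z) T C ∩
        REventT ends (U \ Z) T (W ∪ frontier ends U Z ω)) := by
  rw [QEventT_inter_REventT_union_eq hZU hTZ C W]
  exact prob_tower p (disjoint_touches_within_sdiff ends U Z) (dependsOn_frontier ends U Z)
    fun S => dependsOn_inter_same (dependsOn_QEventT ends (U \ Z) T C)
      (dependsOn_REventT ends (U \ Z) T (W ∪ S))

end MultiDMP

/-! ## The inequality -/

section MultiMain

variable {V : Type*} {E : Type*} [Fintype E] [DecidableEq E] [Fintype V] [DecidableEq V]
  {R : Type*} [CommRing R] [LinearOrder R] [IsStrictOrderedRing R]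

omit [Fintype V] in
/-- The case `X ∩ Y = ∅`: Harris' inequality applied twice. -/
lemma vdBK_multi_induced_of_inter_eq_empty (p : E → R) (hp : IsProbVec p) (ends : E → Sym2 V)
    (U T : Finset V) (A B : V → Finset V) (X Y : Finset V) (hZ : X ∩ Y = ∅) :
    prob p (QEventT ends U T A ∩ REventT ends U T X) *
        prob p (QEventT ends U T B ∩ REventT ends U T Y) ≤
      prob p (QEventT ends U T (fun s => A s ∪ B s) ∩ REventT ends U T (X ∩ Y)) *
        prob p (REventT ends U T (X ∪ Y)) := by
  rw [hZ, REventT_empty, Set.inter_univ, QEventT_union, REventT_union]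
  have hQA := isUpperSet_QEventT ends U T A
  have hQB := isUpperSet_QEventT ends U T B
  have hRX := isLowerSet_REventT ends U T X
  have hRY := isLowerSet_REventT ends U T Y
  have h1 : prob p (QEventT ends U T A ∩ REventT ends U T X) ≤
      prob p (QEventT ends U T A) * prob p (REventT ends U T X) := by
    rw [Set.inter_comm, mul_comm]
    exact prob_inter_le_prob_mul_prob_of_isLowerSet hp hRX hQA
  have h2 : prob p (QEventT ends U T B ∩ REventT ends U T Y) ≤
      prob p (QEventT ends U T B) * prob p (REventT ends U T Y) := by
    rw [Set.inter_comm, mul_comm]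
    exact prob_inter_le_prob_mul_prob_of_isLowerSet hp hRY hQB
  have h3 := prob_mul_prob_le_prob_inter hp hQA hQB
  have h4 := prob_mul_prob_le_prob_inter_of_isLowerSet hp hRX hRY
  calc prob p (QEventT ends U T A ∩ REventT ends U T X) *
        prob p (QEventT ends U T B ∩ REventT ends U T Y)
      ≤ (prob p (QEventT ends U T A) * prob p (REventT ends U T X)) *
          (prob p (QEventT ends U T B) * prob p (REventT ends U T Y)) :=
        mul_le_mul h1 h2 (prob_nonneg hp _) (mul_nonneg (prob_nonneg hp _) (prob_nonneg hp _))
    _ = (prob p (QEventT ends U T A) * prob p (QEventT ends U T B)) *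
          (prob p (REventT ends U T X) * prob p (REventT ends U T Y)) := by ring
    _ ≤ prob p (QEventT ends U T A ∩ QEventT ends U T B) *
          prob p (REventT ends U T X ∩ REventT ends U T Y) :=
        mul_le_mul h3 h4 (mul_nonneg (prob_nonneg hp _) (prob_nonneg hp _)) (prob_nonneg hp _)

/-- **Multi-source van den Berg–Kahn inequality on induced subgraphs**: for a set of sources `T`,
every vertex set `U` and all `A, B, X, Y` with `X, Y ⊆ U`,
`P(Q^U_{T,A} ∩ R^U_{T,X}) · P(Q^U_{T,B} ∩ R^U_{T,Y}) ≤
  P(Q^U_{T,A∪B} ∩ R^U_{T,X∩Y}) · P(R^U_{T,X∪Y})`. -/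
theorem vdBK_multi_induced (p : E → R) (hp : IsProbVec p) (ends : E → Sym2 V) (T : Finset V)
    (U : Finset V) :
    ∀ (A B : V → Finset V) (X Y : Finset V), X ⊆ U → Y ⊆ U →
      prob p (QEventT ends U T A ∩ REventT ends U T X) *
          prob p (QEventT ends U T B ∩ REventT ends U T Y) ≤
        prob p (QEventT ends U T (fun s => A s ∪ B s) ∩ REventT ends U T (X ∩ Y)) *
          prob p (REventT ends U T (X ∪ Y)) := by
  induction U using Finset.strongInduction with
  | H U ih =>
  intro A B X Y hX hY
  by_cases hZ : X ∩ Y = ∅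
  · exact vdBK_multi_induced_of_inter_eq_empty p hp ends U T A B X Y hZ
  -- the exploration step: `Z = X ∩ Y ≠ ∅`
  set Z := X ∩ Y with hZdef
  have hZX : Z ⊆ X := Finset.inter_subset_left
  have hZY : Z ⊆ Y := Finset.inter_subset_right
  have hZU : Z ⊆ U := hZX.trans hX
  by_cases hTZ : ∀ s ∈ T, s ∉ Z
  swap
  · -- a source lies in `X`: the left side vanishes
    simp only [not_forall, not_not, exists_prop] at hTZ
    obtain ⟨s, hs, hsZ⟩ := hTZ
    rw [REventT_eq_empty_of_mem ends U hs (hZX hsZ), Set.inter_empty, prob_empty, zero_mul]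
    exact mul_nonneg (prob_nonneg hp _) (prob_nonneg hp _)
  have hU' : U \ Z ⊂ U := Finset.sdiff_ssubset hZU (Finset.nonempty_iff_ne_empty.2 hZ)
  -- the four terms as sums over configurations (domain Markov identity)
  have e1 : prob p (QEventT ends U T A ∩ REventT ends U T X) =
      ∑ ω, weight p ω * prob p (QEventT ends (U \ Z) T A ∩
        REventT ends (U \ Z) T ((X \ Z) ∪ frontier ends U Z ω)) := by
    rw [← prob_QEventT_inter_REventT_union p ends hZU hTZ A (X \ Z),
      Finset.sdiff_union_of_subset hZX]
  have e2 : prob p (QEventT ends U T B ∩ REventT ends U T Y) =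
      ∑ ω, weight p ω * prob p (QEventT ends (U \ Z) T B ∩
        REventT ends (U \ Z) T ((Y \ Z) ∪ frontier ends U Z ω)) := by
    rw [← prob_QEventT_inter_REventT_union p ends hZU hTZ B (Y \ Z),
      Finset.sdiff_union_of_subset hZY]
  have e3 : prob p (QEventT ends U T (fun s => A s ∪ B s) ∩ REventT ends U T Z) =
      ∑ ω, weight p ω * prob p (QEventT ends (U \ Z) T (fun s => A s ∪ B s) ∩
        REventT ends (U \ Z) T (∅ ∪ frontier ends U Z ω)) := by
    rw [← prob_QEventT_inter_REventT_union p ends hZU hTZ (fun s => A s ∪ B s) ∅,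
      Finset.empty_union]
  have e4 : prob p (REventT ends U T (X ∪ Y)) =
      ∑ ω, weight p ω * prob p (QEventT ends (U \ Z) T (fun _ => ∅) ∩
        REventT ends (U \ Z) T (((X \ Z) ∪ (Y \ Z)) ∪ frontier ends U Z ω)) := by
    rw [← prob_QEventT_inter_REventT_union p ends hZU hTZ (fun _ => ∅) ((X \ Z) ∪ (Y \ Z)),
      QEventT_empty, Set.univ_inter, ← Finset.union_sdiff_distrib,
      Finset.sdiff_union_of_subset (hZX.trans Finset.subset_union_left)]
  rw [e1, e2, e3, e4]
  -- the four functions theorem on the lattice `Config E`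
  refine four_functions_theorem_univ
    (fun ω => weight p ω * prob p (QEventT ends (U \ Z) T A ∩
      REventT ends (U \ Z) T ((X \ Z) ∪ frontier ends U Z ω)))
    (fun ω => weight p ω * prob p (QEventT ends (U \ Z) T B ∩
      REventT ends (U \ Z) T ((Y \ Z) ∪ frontier ends U Z ω)))
    (fun ω => weight p ω * prob p (QEventT ends (U \ Z) T (fun s => A s ∪ B s) ∩
      REventT ends (U \ Z) T (∅ ∪ frontier ends U Z ω)))
    (fun ω => weight p ω * prob p (QEventT ends (U \ Z) T (fun _ => ∅) ∩
      REventT ends (U \ Z) T (((X \ Z) ∪ (Y \ Z)) ∪ frontier ends U Z ω)))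
    (fun ω => mul_nonneg (weight_nonneg hp ω) (prob_nonneg hp _))
    (fun ω => mul_nonneg (weight_nonneg hp ω) (prob_nonneg hp _))
    (fun ω => mul_nonneg (weight_nonneg hp ω) (prob_nonneg hp _))
    (fun ω => mul_nonneg (weight_nonneg hp ω) (prob_nonneg hp _)) ?_
  intro ω ω'
  -- induction hypothesis on `U ∖ Z` with the frontiers added to the avoided sets
  have hX'' : (X \ Z) ∪ frontier ends U Z ω ⊆ U \ Z :=
    Finset.union_subset (Finset.sdiff_subset_sdiff hX (le_refl Z)) (frontier_subset ω)
  have hY'' : (Y \ Z) ∪ frontier ends U Z ω' ⊆ U \ Z :=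
    Finset.union_subset (Finset.sdiff_subset_sdiff hY (le_refl Z)) (frontier_subset ω')
  have hIH := ih (U \ Z) hU' A B ((X \ Z) ∪ frontier ends U Z ω)
    ((Y \ Z) ∪ frontier ends U Z ω') hX'' hY''
  -- `S(ω ⊓ ω') ⊆ S(ω) ∩ S(ω') ⊆ X'' ∩ Y''`
  have h3 : prob p (QEventT ends (U \ Z) T (fun s => A s ∪ B s) ∩ REventT ends (U \ Z) T
      (((X \ Z) ∪ frontier ends U Z ω) ∩ ((Y \ Z) ∪ frontier ends U Z ω'))) ≤
      prob p (QEventT ends (U \ Z) T (fun s => A s ∪ B s) ∩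
        REventT ends (U \ Z) T (∅ ∪ frontier ends U Z (ω ⊓ ω'))) := by
    refine prob_mono hp (Set.inter_subset_inter_right _ (REventT_anti _ _ _ ?_))
    rw [Finset.empty_union]
    exact (frontier_inf_subset ω ω').trans
      (Finset.inter_subset_inter Finset.subset_union_right Finset.subset_union_right)
  -- `X'' ∪ Y'' = (X' ∪ Y') ∪ S(ω ⊔ ω')`
  have h4 : prob p (REventT ends (U \ Z) T
      (((X \ Z) ∪ frontier ends U Z ω) ∪ ((Y \ Z) ∪ frontier ends U Z ω'))) =
      prob p (QEventT ends (U \ Z) T (fun _ => ∅) ∩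
        REventT ends (U \ Z) T (((X \ Z) ∪ (Y \ Z)) ∪ frontier ends U Z (ω ⊔ ω'))) := by
    rw [QEventT_empty, Set.univ_inter, frontier_sup]
    congr 2
    ext x
    simp only [Finset.mem_union]
    tauto
  calc weight p ω * prob p (QEventT ends (U \ Z) T A ∩
          REventT ends (U \ Z) T ((X \ Z) ∪ frontier ends U Z ω)) *
        (weight p ω' * prob p (QEventT ends (U \ Z) T B ∩
          REventT ends (U \ Z) T ((Y \ Z) ∪ frontier ends U Z ω')))
      = (weight p ω * weight p ω') *
          (prob p (QEventT ends (U \ Z) T A ∩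
            REventT ends (U \ Z) T ((X \ Z) ∪ frontier ends U Z ω)) *
          prob p (QEventT ends (U \ Z) T B ∩
            REventT ends (U \ Z) T ((Y \ Z) ∪ frontier ends U Z ω'))) := by ring
    _ ≤ (weight p ω * weight p ω') *
          (prob p (QEventT ends (U \ Z) T (fun s => A s ∪ B s) ∩
            REventT ends (U \ Z) T (∅ ∪ frontier ends U Z (ω ⊓ ω'))) *
          prob p (QEventT ends (U \ Z) T (fun _ => ∅) ∩
            REventT ends (U \ Z) T (((X \ Z) ∪ (Y \ Z)) ∪ frontier ends U Z (ω ⊔ ω')))) :=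
        mul_le_mul_of_nonneg_left
          (hIH.trans (mul_le_mul h3 (le_of_eq h4) (prob_nonneg hp _) (prob_nonneg hp _)))
          (mul_nonneg (weight_nonneg hp ω) (weight_nonneg hp ω'))
    _ = weight p (ω ⊓ ω') * prob p (QEventT ends (U \ Z) T (fun s => A s ∪ B s) ∩
          REventT ends (U \ Z) T (∅ ∪ frontier ends U Z (ω ⊓ ω'))) *
        (weight p (ω ⊔ ω') * prob p (QEventT ends (U \ Z) T (fun _ => ∅) ∩
          REventT ends (U \ Z) T (((X \ Z) ∪ (Y \ Z)) ∪ frontier ends U Z (ω ⊔ ω')))) := by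
        rw [← weight_inf_mul_weight_sup p ω ω']
        ring

end MultiMain

/-! ## The inequality on the whole graph -/

section MultiWhole

variable {V : Type*} {E : Type*} [Fintype E] [DecidableEq E] [Fintype V] [DecidableEq V]
  {R : Type*} [CommRing R] [LinearOrder R] [IsStrictOrderedRing R]

omit [Fintype E] [DecidableEq E] [DecidableEq V] in
/-- `Q^{univ}_{T,A}` is the whole-graph event. -/
lemma QEventT_univ (ends : E → Sym2 V) (T : Finset V) (A : V → Finset V) :
    QEventT ends Finset.univ T A = connAllT ends T A := by
  ext ω
  simp only [mem_QEventT, connAllT, Set.mem_setOf_eq, Finset.coe_univ, induced_univ]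

omit [Fintype E] [DecidableEq E] [DecidableEq V] in
/-- `R^{univ}_{T,X}` is the whole-graph event. -/
lemma REventT_univ (ends : E → Sym2 V) (T : Finset V) (X : Finset V) :
    REventT ends Finset.univ T X = avoidAllT ends T X := by
  ext ω
  simp only [mem_REventT, avoidAllT, Set.mem_setOf_eq, Finset.coe_univ, induced_univ]

/-- **Multi-source van den Berg–Kahn inequality**: for a set of sources `T` of a finite graph,
target assignments `A, B : V → Finset V` and vertex sets `X, Y`,
`P(Q_A ∩ R_X) · P(Q_B ∩ R_Y) ≤ P(Q_{A∪B} ∩ R_{X∩Y}) · P(R_{X∪Y})`, where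
`Q_A = {s ↔ a ∀ s ∈ T, a ∈ A s}` and `R_X = {s ↮ x ∀ s ∈ T, x ∈ X}`. The case `T = {s}` is
van den Berg–Kahn's Theorem 1.2 (`vdBK`). -/
theorem vdBK_multi (p : E → R) (hp : IsProbVec p) (ends : E → Sym2 V) (T : Finset V)
    (A B : V → Finset V) (X Y : Finset V) :
    prob p (connAllT ends T A ∩ avoidAllT ends T X) *
        prob p (connAllT ends T B ∩ avoidAllT ends T Y) ≤
      prob p (connAllT ends T (fun s => A s ∪ B s) ∩ avoidAllT ends T (X ∩ Y)) *
        prob p (avoidAllT ends T (X ∪ Y)) := by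
  have h := vdBK_multi_induced p hp ends T Finset.univ A B X Y (Finset.subset_univ X)
    (Finset.subset_univ Y)
  simpa only [QEventT_univ, REventT_univ] using h

/-- **Two sources, one avoided vertex**: conditionally on `{s₁ ↮ t, s₂ ↮ t}` the events `s₁ ↔ a`
and `s₂ ↔ b` are positively correlated, in the unconditional form
`P(s₁↔a, s₂↔b, D) · P(D) ≥ P(s₁↔a, D) · P(s₂↔b, D)` with `D = {s₁ ↮ t} ∩ {s₂ ↮ t}`. -/
theorem vdBK_two_sources (p : E → R) (hp : IsProbVec p) (ends : E → Sym2 V) {s₁ s₂ : V}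
    (hs : s₁ ≠ s₂) (a b t : V) :
    prob p (connEvent ends s₁ a ∩ ((connEvent ends s₁ t)ᶜ ∩ (connEvent ends s₂ t)ᶜ)) *
        prob p (connEvent ends s₂ b ∩ ((connEvent ends s₁ t)ᶜ ∩ (connEvent ends s₂ t)ᶜ)) ≤
      prob p (connEvent ends s₁ a ∩ connEvent ends s₂ b ∩
          ((connEvent ends s₁ t)ᶜ ∩ (connEvent ends s₂ t)ᶜ)) *
        prob p ((connEvent ends s₁ t)ᶜ ∩ (connEvent ends s₂ t)ᶜ) := by
  have h := vdBK_multi p hp ends {s₁, s₂} (fun s => if s = s₁ then {a} else ∅)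
    (fun s => if s = s₂ then {b} else ∅) {t} {t}
  have eD : avoidAllT ends {s₁, s₂} {t} = (connEvent ends s₁ t)ᶜ ∩ (connEvent ends s₂ t)ᶜ := by
    ext ω; simp [avoidAllT]
  have eA : connAllT ends {s₁, s₂} (fun s => if s = s₁ then {a} else ∅) =
      connEvent ends s₁ a := by
    ext ω; simp [connAllT, Ne.symm hs]
  have eB : connAllT ends {s₁, s₂} (fun s => if s = s₂ then {b} else ∅) =
      connEvent ends s₂ b := by
    ext ω; simp [connAllT, hs]
  have eAB : connAllT ends {s₁, s₂}
      (fun s => (if s = s₁ then {a} else ∅) ∪ (if s = s₂ then {b} else ∅)) =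
      connEvent ends s₁ a ∩ connEvent ends s₂ b := by
    ext ω; simp [connAllT, hs, Ne.symm hs]
  simp only [Finset.inter_self, Finset.union_self, eD, eA, eB, eAB] at h
  exact h

end MultiWhole

end Summit.Ventures.PercRepro2
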